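import Summits.AnomalousDissipation.AnomalousDissipation.Theorems.SawtoothPulseCascadeK1LocalisedCascadeSlotPartitionStep

/-!
# K1loc, line `Spectral` / SeqCone — helper: THE PER-FIBRE TWO-STRIP ESTIMATE UNDER MAX-COMPATIBILITY

Helper file of the prover lane on the crux `K1LocalisedCascade` (stmt-AnomalousDissipation-19491), route
`SawtoothPulseCascade` (memo v5 §4, the "weight doubling" design question).  `…SlotFibreExpansion` bounds each branch
`e_{−b^σ e_j} Θ^σ G` of the un-gauged fibre by the FULL fibre function `G`, which forces the SUM-compatibility
`m(k − b⁺e_j)² + m(k − b⁻e_j)² ≤ μ(k)²` when the two strip families are added.  Here each branch is dominated by the old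
symbol `μ` separately (`…SlotPartitionStep.sqrt_tsum_symbol_sq_branch_le_max`, principal term `‖Θ^σ·μ(D)G‖` kept) and the
families are added with the partition inequality `‖Θ⁺h‖² + ‖Θ⁻h‖² ≤ ‖h‖²` (`X⁺² + X⁻² ≤ 1`).  Result
(`tsum_symbol_sq_twoStrip_fibre_le_max`, one fibre `k_i = n`):
  `Σ' m²|𝓕((X⁺+X⁻)(x_j)·(G∘Φ))|² ≤ (√Σ' μ²|𝓕G|² + √(A⁺²+A⁻²)‖G‖)² + 2C‖G‖²`
under the MAX-compatibility `m(k − b^σ e_j)² ≤ μ(k)²` for each `σ` — the shape of the abstract per-fibre hypothesis of the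
fibre summation `…SlotFibreSumMax`.  No definitions; no statement about the stub.
[cite: Grafakos2014, Prop. 3.1.2 (5) (coefficients of products, translations and modulations) and Prop. 3.2.7 (3)
(Parseval)] [problem: turb]
-/

-- `Summit.<Summit>.<Problem>`: single-conjunct summit, the duplicate namespace segment is deliberate.
set_option linter.dupNamespace false

noncomputable section

namespace Summit.AnomalousDissipation.AnomalousDissipation.Theorems.SawtoothPulseCascade.K1Slot

open MeasureTheory Set Filter Topology UnitAddTorus Complex
open scoped ComplexConjugate
open Literature.Analysis Literature.Analysis.FunctionSpaces Literature.Analysis.FluidPDE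
open Literature.Analysis.FunctionSpaces.Torus
open Summit.AnomalousDissipation.AnomalousDissipation.Theorems.SawtoothPulseCascade.SpectralLeakage

variable {d : Type*} [Fintype d]

/-! ## The per-fibre two-strip estimate under max-compatibility -/

variable [DecidableEq d]

/-- The un-gauging multiplier is a function of `x_j` alone: invariant under translations along any other axis.
[folklore] -/
theorem ungaugeMultiplier_add_single (P X : ShearProfile) (n : ℤ) {i j : d} (hij : i ≠ j) (b : ℤ)
    (t : UnitAddCircle) (x : UnitAddTorus d) :
    (X.onCircle ((x + Pi.single i t : UnitAddTorus d) j) : ℂ) * twist P n ((x + Pi.single i t : UnitAddTorus d) j) *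
        mFourier (Pi.single j b) (x + Pi.single i t) =
      (X.onCircle (x j) : ℂ) * twist P n (x j) * mFourier (Pi.single j b) x := by
  have hj : (x + Pi.single i t : UnitAddTorus d) j = x j := by simp [Pi.single_eq_of_ne hij.symm]
  rw [hj, Torus.mFourier_single, Torus.mFourier_single, hj]

/-- **The per-fibre two-strip estimate under MAX-compatibility** (one fibre `k_i = n`).  Data as in
`tsum_symbol_sq_twoStrip_fibre_le_of_expansion`, except: (i) the strip cut-offs form a sub-partition,
`X⁺(y)² + X⁻(y)² ≤ 1`; (ii) the new symbol `m` is dominated on the fibre, BRANCH BY BRANCH, by an old symbol `μ`: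
`m(k − b⁺e_j)² ≤ μ(k)²` and `m(k − b⁻e_j)² ≤ μ(k)²` (no sum); (iii) the expansion data of order `r ≥ 1` (derivative
symbols `μ_α`, `μ_0 = μ_n`, remainder `L ρ`) are those of the fibre version `μ_n` of the OLD symbol, with `Θ^±_0 = Θ^±`;
the cross term keeps the data `ν_α`, `L₂ ρ₂` of the squared shifted new symbol `m_n(· − b⁺e_j)²`.  Conclusion:
`Σ' m²|𝓕((X⁺+X⁻)(x_j)·(G∘Φ))|² ≤ (√Σ' μ²|𝓕G|² + √(A⁺²+A⁻²)‖G‖)² + 2C‖G‖²`,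
`A^± = Σ_{1≤α<r} B^±_α M_α + L Σρ|𝓕Θ^±|`, `C = L₂ Σρ₂|𝓕Θ⁺|` — the two families are summed by the partition inequality
`‖Θ⁺·μ(D)G‖² + ‖Θ⁻·μ(D)G‖² ≤ ‖μ(D)G‖²`, so no weight doubling is needed. [cite: Grafakos2014, Prop. 3.1.2 (5) and Prop. 3.2.7 (3)] -/
theorem tsum_symbol_sq_twoStrip_fibre_le_max {G : UnitAddTorus d → ℂ} {i j : d} (hG : IsSmooth G)
    (hij : i ≠ j) {n : ℤ} (hn : ∀ k, mFourierCoeff G k ≠ 0 → k i = n) (P Xp Xm : ShearProfile)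
    (hXm1 : ∀ y, |Xm y| ≤ 1) (hpart : ∀ y, Xp y ^ 2 + Xm y ^ 2 ≤ 1) (bp bm : ℤ)
    {r : ℕ} (hr : 0 < r)
    {Θpd Θmd : ℕ → UnitAddTorus d → ℂ} (hΘpd_c : ∀ α ∈ Finset.range r, Continuous (Θpd α))
    (hΘpd_s : ∀ α ∈ Finset.range r, Summable fun q => ‖mFourierCoeff (Θpd α) q‖)
    (hΘpd : ∀ α ∈ Finset.range r, ∀ q, mFourierCoeff (Θpd α) q = (2 * Real.pi * I * (q j : ℂ)) ^ α *
      mFourierCoeff (fun x : UnitAddTorus d => (Xp.onCircle (x j) : ℂ) * twist P n (x j) * mFourier (Pi.single j bp) x) q)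
    (hΘpd0 : Θpd 0 = fun x : UnitAddTorus d => (Xp.onCircle (x j) : ℂ) * twist P n (x j) * mFourier (Pi.single j bp) x)
    (hΘmd_c : ∀ α ∈ Finset.range r, Continuous (Θmd α))
    (hΘmd_s : ∀ α ∈ Finset.range r, Summable fun q => ‖mFourierCoeff (Θmd α) q‖)
    (hΘmd : ∀ α ∈ Finset.range r, ∀ q, mFourierCoeff (Θmd α) q = (2 * Real.pi * I * (q j : ℂ)) ^ α *
      mFourierCoeff (fun x : UnitAddTorus d => (Xm.onCircle (x j) : ℂ) * twist P n (x j) * mFourier (Pi.single j bm) x) q)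
    (hΘmd0 : Θmd 0 = fun x : UnitAddTorus d => (Xm.onCircle (x j) : ℂ) * twist P n (x j) * mFourier (Pi.single j bm) x)
    {Bp Bm : ℕ → ℝ} (hBp : ∀ α ∈ Finset.range r, ∀ x, ‖Θpd α x‖ ≤ Bp α) (hBm : ∀ α ∈ Finset.range r, ∀ x, ‖Θmd α x‖ ≤ Bm α)
    (hdis : ∀ α ∈ Finset.range r, ∀ x, conj (Θpd α x) *
      ((Xm.onCircle (x j) : ℂ) * twist P n (x j) * mFourier (Pi.single j bm) x) = 0)
    {m mn : (d → ℤ) → ℝ} (hmn : ∀ k, k i = n → mn k = m k) {M : ℝ} (hmnM : ∀ k, |mn k| ≤ M)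
    {μ μn : (d → ℤ) → ℝ} (hμn : ∀ k, k i = n → μn k = μ k) {Mμ : ℝ} (hμnM : ∀ k, |μn k| ≤ Mμ)
    (hcomp_p : ∀ k : d → ℤ, k i = n → m (k - Pi.single j bp) ^ 2 ≤ μ k ^ 2)
    (hcomp_m : ∀ k : d → ℤ, k i = n → m (k - Pi.single j bm) ^ 2 ≤ μ k ^ 2)
    {μd νd : ℕ → (d → ℤ) → ℂ} (hμd0 : ∀ k, μd 0 k = (μn k : ℂ)) {Mα : ℕ → ℝ}
    (hMα : ∀ α ∈ Finset.range r, ∀ k, ‖μd α k‖ ≤ Mα α) {Md : ℝ} (hνd : ∀ α ∈ Finset.range r, ∀ k, ‖νd α k‖ ≤ Md)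
    {ρ ρ₂ : (d → ℤ) → ℝ} {L L₂ : ℝ} (hρ0 : ∀ q, 0 ≤ ρ q) (hρ₂0 : ∀ q, 0 ≤ ρ₂ q) (hL : 0 ≤ L) (hL₂ : 0 ≤ L₂)
    (hT : ∀ k q, mFourierCoeff (fun x : UnitAddTorus d => (Xp.onCircle (x j) : ℂ) * twist P n (x j) *
        mFourier (Pi.single j bp) x) q ≠ 0 ∨ mFourierCoeff (fun x : UnitAddTorus d => (Xm.onCircle (x j) : ℂ) *
        twist P n (x j) * mFourier (Pi.single j bm) x) q ≠ 0 →
      ‖(μn k : ℂ) - ∑ α ∈ Finset.range r, (2 * Real.pi * I * (q j : ℂ)) ^ α * μd α (k - q)‖ ≤ L * ρ q)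
    (hT₂ : ∀ k q, mFourierCoeff (fun x : UnitAddTorus d => (Xp.onCircle (x j) : ℂ) * twist P n (x j) *
        mFourier (Pi.single j bp) x) q ≠ 0 →
      ‖((mn (k + Pi.single j (-bp)) ^ 2 : ℝ) : ℂ) - ∑ α ∈ Finset.range r, (2 * Real.pi * I * (q j : ℂ)) ^ α * νd α (k - q)‖ ≤
        L₂ * ρ₂ q)
    (hρp : Summable fun q => ρ q * ‖mFourierCoeff (fun x : UnitAddTorus d => (Xp.onCircle (x j) : ℂ) * twist P n (x j) *
        mFourier (Pi.single j bp) x) q‖)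
    (hρm : Summable fun q => ρ q * ‖mFourierCoeff (fun x : UnitAddTorus d => (Xm.onCircle (x j) : ℂ) * twist P n (x j) *
        mFourier (Pi.single j bm) x) q‖)
    (hρ₂ : Summable fun q => ρ₂ q * ‖mFourierCoeff (fun x : UnitAddTorus d => (Xp.onCircle (x j) : ℂ) * twist P n (x j) *
        mFourier (Pi.single j bp) x) q‖) :
    ∑' k, m k ^ 2 * ‖mFourierCoeff (fun x => ((Xp.onCircle (x j) : ℂ) + Xm.onCircle (x j)) * G (shearMap i j P x)) k‖ ^ 2 ≤
      (Real.sqrt (∑' k, μ k ^ 2 * ‖mFourierCoeff G k‖ ^ 2) +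
          Real.sqrt ((∑ α ∈ Finset.Ico 1 r, Bp α * Mα α + L * ∑' q, ρ q * ‖mFourierCoeff (fun x : UnitAddTorus d =>
              (Xp.onCircle (x j) : ℂ) * twist P n (x j) * mFourier (Pi.single j bp) x) q‖) ^ 2 +
            (∑ α ∈ Finset.Ico 1 r, Bm α * Mα α + L * ∑' q, ρ q * ‖mFourierCoeff (fun x : UnitAddTorus d =>
              (Xm.onCircle (x j) : ℂ) * twist P n (x j) * mFourier (Pi.single j bm) x) q‖) ^ 2) *
          Real.sqrt (∫ x, ‖G x‖ ^ 2)) ^ 2 +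
        2 * (L₂ * ∑' q, ρ₂ q * ‖mFourierCoeff (fun x : UnitAddTorus d =>
            (Xp.onCircle (x j) : ℂ) * twist P n (x j) * mFourier (Pi.single j bp) x) q‖) * ∫ x, ‖G x‖ ^ 2 := by
  -- the multipliers
  set Θp : UnitAddTorus d → ℂ := fun x => (Xp.onCircle (x j) : ℂ) * twist P n (x j) * mFourier (Pi.single j bp) x
    with hΘp_def
  set Θm : UnitAddTorus d → ℂ := fun x => (Xm.onCircle (x j) : ℂ) * twist P n (x j) * mFourier (Pi.single j bm) x
    with hΘm_def
  have hΘp_smooth : IsSmooth Θp := isSmooth_ungaugeMultiplier P Xp n j bp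
  have hΘm_smooth : IsSmooth Θm := isSmooth_ungaugeMultiplier P Xm n j bm
  have hΘm1 : ∀ x, ‖Θm x‖ ≤ 1 := fun x => norm_ungaugeMultiplier_le P Xm hXm1 n j bm x
  have hΘpart : ∀ x, ‖Θp x‖ ^ 2 + ‖Θm x‖ ^ 2 ≤ 1 := by
    intro x
    rw [hΘp_def, hΘm_def, norm_ungaugeMultiplier_eq, norm_ungaugeMultiplier_eq, sq_abs, sq_abs]
    obtain ⟨y, rfl⟩ := proj_surjective x
    rw [proj_apply, ShearProfile.onCircle_coe, ShearProfile.onCircle_coe]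
    exact hpart _
  have hGc := hG.continuous
  have hGs := hG.rapidDecay_mFourierCoeff.summable_norm
  -- un-gauge both strips
  have hsplit : (fun x => ((Xp.onCircle (x j) : ℂ) + Xm.onCircle (x j)) * G (shearMap i j P x)) =
      fun x => mFourier (Pi.single j (-bp)) x * (Θp x * G x) + mFourier (Pi.single j (-bm)) x * (Θm x * G x) := by
    have hp := ungauge_fibre_eq hG hn P Xp j bp
    have hm := ungauge_fibre_eq hG hn P Xm j bm
    funext x
    have hp' := congrFun hp x
    have hm' := congrFun hm x
    simp only [Function.comp_apply] at hp' hm'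
    simp only [hΘp_def, hΘm_def, add_mul]
    rw [hp', hm']
  -- the left-hand symbol may be replaced by its fibre version
  have hH_supp : ∀ k, mFourierCoeff (fun x => ((Xp.onCircle (x j) : ℂ) + Xm.onCircle (x j)) * G (shearMap i j P x)) k ≠ 0 →
      k i = n := by
    intro k hk
    by_contra h
    have hΞ_inv : ∀ (t : UnitAddCircle) (x : UnitAddTorus d),
        ((Xp.onCircle ((x + Pi.single i t : UnitAddTorus d) j) : ℂ) +
            Xm.onCircle ((x + Pi.single i t : UnitAddTorus d) j)) =
          (Xp.onCircle (x j) : ℂ) + Xm.onCircle (x j) := fun t x => by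
      simp [Pi.single_eq_of_ne hij.symm]
    have hψ_supp : ∀ k, mFourierCoeff (G ∘ shearMap i j P) k ≠ 0 → k i = n := by
      intro k' hk'
      by_contra h'
      exact hk' (mFourierCoeff_comp_shearMap_eq_zero_of_apply_not_mem hG.continuous
        hG.rapidDecay_mFourierCoeff.summable_norm hij P (A := {n}) (fun k'' hk'' => not_not.1 fun h'' => hk'' (hn k'' h'')) h')
    exact hk (mFourierCoeff_mul_eq_zero_of_fibre (θ := G ∘ shearMap i j P) hΞ_inv (hG.comp_shearMap i j P) hψ_supp h)
  have hLsum : ∑' k, mn k ^ 2 * ‖mFourierCoeff (fun x => ((Xp.onCircle (x j) : ℂ) + Xm.onCircle (x j)) *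
      G (shearMap i j P x)) k‖ ^ 2 = ∑' k, m k ^ 2 * ‖mFourierCoeff (fun x => ((Xp.onCircle (x j) : ℂ) + Xm.onCircle (x j)) *
      G (shearMap i j P x)) k‖ ^ 2 :=
    tsum_symbol_sq_congr_of_supp fun k hk => by rw [hmn k (hH_supp k hk)]
  rw [← hLsum, hsplit]
  -- the products `Θ^σ G` have their modes on the fibre, so the domination hypotheses apply to them
  have hΘG_supp : ∀ (X : ShearProfile) (b : ℤ) (k : d → ℤ),
      mFourierCoeff (fun x => ((X.onCircle (x j) : ℂ) * twist P n (x j) * mFourier (Pi.single j b) x) * G x) k ≠ 0 →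
        k i = n := by
    intro X b k hk
    by_contra h
    exact hk (mFourierCoeff_mul_eq_zero_of_fibre (θ := G) (fun t x => ungaugeMultiplier_add_single P X n hij b t x) hG hn h)
  have hshift : ∀ (b : ℤ) (k : d → ℤ), k i = n → mn (k + Pi.single j (-b)) = m (k - Pi.single j b) := by
    intro b k hk
    rw [Pi.single_neg, ← sub_eq_add_neg]
    exact hmn _ (by rw [Pi.sub_apply, Pi.single_eq_of_ne hij, sub_zero, hk])
  have hdom_p : ∀ k, mFourierCoeff (fun x => Θp x * G x) k ≠ 0 → mn (k + Pi.single j (-bp)) ^ 2 ≤ μn k ^ 2 := by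
    intro k hk
    have hki := hΘG_supp Xp bp k hk
    rw [hshift bp k hki, hμn k hki]
    exact hcomp_p k hki
  have hdom_m : ∀ k, mFourierCoeff (fun x => Θm x * G x) k ≠ 0 → mn (k + Pi.single j (-bm)) ^ 2 ≤ μn k ^ 2 := by
    intro k hk
    have hki := hΘG_supp Xm bm k hk
    rw [hshift bm k hki, hμn k hki]
    exact hcomp_m k hki
  -- the two dominated branches, principal terms kept
  have hXp := sqrt_tsum_symbol_sq_branch_le_max (m := mn) hGc hGs hΘp_smooth.continuous
    hΘp_smooth.rapidDecay_mFourierCoeff.summable_norm (Pi.single j (-bp)) j hr hΘpd_c hΘpd_s hΘpd hΘpd0 hBp hμnM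
    hdom_p hμd0 hMα hρ0 hL (fun k q hq => hT k q (Or.inl hq)) hρp
  have hXm := sqrt_tsum_symbol_sq_branch_le_max (m := mn) hGc hGs hΘm_smooth.continuous
    hΘm_smooth.rapidDecay_mFourierCoeff.summable_norm (Pi.single j (-bm)) j hr hΘmd_c hΘmd_s hΘmd hΘmd0 hBm hμnM
    hdom_m hμd0 hMα hρ0 hL (fun k q hq => hT k q (Or.inr hq)) hρm
  -- the cross term
  have hc := norm_tsum_symbol_sq_cross_le_of_expansion (m := mn) hGc hGs hΘp_smooth.continuous
    hΘp_smooth.rapidDecay_mFourierCoeff.summable_norm hΘm_smooth.continuous hΘm1 (Pi.single j (-bp))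
    (Pi.single j (-bm)) j r hΘpd_c hΘpd_s hΘpd hdis hνd hρ₂0 hL₂ hT₂ hρ₂
  -- two-piece bookkeeping
  have hPp : Continuous fun x => mFourier (Pi.single j (-bp)) x * (Θp x * G x) :=
    (mFourier _).continuous.mul (hΘp_smooth.continuous.mul hGc)
  have hPm : Continuous fun x => mFourier (Pi.single j (-bm)) x * (Θm x * G x) :=
    (mFourier _).continuous.mul (hΘm_smooth.continuous.mul hGc)
  have h2 := tsum_symbol_sq_add_le_of_bounds hPp hPm hmnM hXp hXm hc
  -- the principal terms are summed by the partition inequality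
  set h : UnitAddTorus d → ℂ := fourierSynth (fun k => (μn k : ℂ) * mFourierCoeff G k) with hh_def
  have hhs : Summable fun k => ‖(μn k : ℂ) * mFourierCoeff G k‖ := by
    have hM0 : 0 ≤ Mμ := (abs_nonneg _).trans (hμnM 0)
    refine (hGs.mul_left Mμ).of_nonneg_of_le (fun _ => norm_nonneg _) fun k => ?_
    rw [norm_mul, Complex.norm_real, Real.norm_eq_abs]
    exact mul_le_mul_of_nonneg_right (hμnM k) (norm_nonneg _)
  have hh_c : Continuous h := continuous_fourierSynth hhs
  have hh_pars : ∫ x, ‖h x‖ ^ 2 = ∑' k, μ k ^ 2 * ‖mFourierCoeff G k‖ ^ 2 := by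
    have hP := hasSum_sq_mFourierCoeff_of_continuous hh_c
    rw [← hP.tsum_eq]
    have h1 : ∑' k, ‖mFourierCoeff h k‖ ^ 2 = ∑' k, μn k ^ 2 * ‖mFourierCoeff G k‖ ^ 2 := tsum_congr fun k => by
      rw [hh_def, mFourierCoeff_fourierSynth hhs, norm_mul, Complex.norm_real, Real.norm_eq_abs, mul_pow, sq_abs]
    rw [h1]
    exact tsum_symbol_sq_congr_of_supp (μ := μn) (ν := μ) fun k hk => by rw [hμn k (hn k hk)]
  have hsum := integral_norm_sq_mul_add_le hΘp_smooth.continuous hΘm_smooth.continuous hh_c hΘpart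
  rw [hh_pars] at hsum
  -- assemble
  set ap := Real.sqrt (∫ x, ‖Θp x * h x‖ ^ 2) with hap_def
  set am := Real.sqrt (∫ x, ‖Θm x * h x‖ ^ 2) with ham_def
  set g := Real.sqrt (∫ x, ‖G x‖ ^ 2) with hg_def
  set Ap := ∑ α ∈ Finset.Ico 1 r, Bp α * Mα α + L * ∑' q, ρ q * ‖mFourierCoeff Θp q‖ with hAp_def
  set Am := ∑ α ∈ Finset.Ico 1 r, Bm α * Mα α + L * ∑' q, ρ q * ‖mFourierCoeff Θm q‖ with hAm_def
  have hg0 : 0 ≤ g := Real.sqrt_nonneg _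
  have hBp0 : ∀ α ∈ Finset.range r, 0 ≤ Bp α := fun α hα => (norm_nonneg _).trans (hBp α hα 0)
  have hBm0 : ∀ α ∈ Finset.range r, 0 ≤ Bm α := fun α hα => (norm_nonneg _).trans (hBm α hα 0)
  have hMα0 : ∀ α ∈ Finset.range r, 0 ≤ Mα α := fun α hα => (norm_nonneg _).trans (hMα α hα 0)
  have hIco : ∀ α ∈ Finset.Ico 1 r, α ∈ Finset.range r := fun α hα => Finset.mem_range.mpr (Finset.mem_Ico.mp hα).2
  have hAp0 : 0 ≤ Ap := add_nonneg (Finset.sum_nonneg fun α hα => mul_nonneg (hBp0 α (hIco α hα)) (hMα0 α (hIco α hα)))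
    (mul_nonneg hL (tsum_nonneg fun q => mul_nonneg (hρ0 q) (norm_nonneg _)))
  have hAm0 : 0 ≤ Am := add_nonneg (Finset.sum_nonneg fun α hα => mul_nonneg (hBm0 α (hIco α hα)) (hMα0 α (hIco α hα)))
    (mul_nonneg hL (tsum_nonneg fun q => mul_nonneg (hρ0 q) (norm_nonneg _)))
  have hap0 : 0 ≤ ap := Real.sqrt_nonneg _
  have ham0 : 0 ≤ am := Real.sqrt_nonneg _
  -- `(ap + Ap g)² + (am + Am g)² ≤ (√(ap²+am²) + √(Ap²+Am²) g)²`
  have hM2 := add_sq_add_add_sq_le hap0 (mul_nonneg hAp0 hg0) ham0 (mul_nonneg hAm0 hg0)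
  have hAg : Real.sqrt ((Ap * g) ^ 2 + (Am * g) ^ 2) = Real.sqrt (Ap ^ 2 + Am ^ 2) * g := by
    rw [show (Ap * g) ^ 2 + (Am * g) ^ 2 = (Ap ^ 2 + Am ^ 2) * g ^ 2 by ring,
      Real.sqrt_mul' _ (sq_nonneg g), Real.sqrt_sq hg0]
  rw [hAg] at hM2
  -- `√(ap² + am²) ≤ √Σ μ²|𝓕G|²`
  have hap2 : ap ^ 2 = ∫ x, ‖Θp x * h x‖ ^ 2 := Real.sq_sqrt (integral_nonneg fun x => by positivity)
  have ham2 : am ^ 2 = ∫ x, ‖Θm x * h x‖ ^ 2 := Real.sq_sqrt (integral_nonneg fun x => by positivity)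
  have hprin : Real.sqrt (ap ^ 2 + am ^ 2) ≤ Real.sqrt (∑' k, μ k ^ 2 * ‖mFourierCoeff G k‖ ^ 2) := by
    rw [hap2, ham2]; exact Real.sqrt_le_sqrt hsum
  have hS0 : 0 ≤ Real.sqrt (Ap ^ 2 + Am ^ 2) * g := mul_nonneg (Real.sqrt_nonneg _) hg0
  have hM3 : (Real.sqrt (ap ^ 2 + am ^ 2) + Real.sqrt (Ap ^ 2 + Am ^ 2) * g) ^ 2 ≤
      (Real.sqrt (∑' k, μ k ^ 2 * ‖mFourierCoeff G k‖ ^ 2) + Real.sqrt (Ap ^ 2 + Am ^ 2) * g) ^ 2 :=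
    pow_le_pow_left₀ (add_nonneg (Real.sqrt_nonneg _) hS0) (add_le_add hprin le_rfl) 2
  have hg2 : g ^ 2 = ∫ x, ‖G x‖ ^ 2 := Real.sq_sqrt (integral_nonneg fun x => by positivity)
  have hcg : L₂ * (∑' q, ρ₂ q * ‖mFourierCoeff Θp q‖) * ∫ x, ‖G x‖ ^ 2 =
      L₂ * (∑' q, ρ₂ q * ‖mFourierCoeff Θp q‖) * g ^ 2 := by rw [hg2]
  rw [hcg] at h2
  rw [← hg2]
  linarith [h2, hM2, hM3]

end Summit.AnomalousDissipation.AnomalousDissipation.Theorems.SawtoothPulseCascade.K1Slot
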